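import Summits.BirchSwinnertonDyer.Rank1Residual.GaloisImage.NonsplitMultiplicativeUnramifiedLocal
import Literature.NumberTheory.EllipticCurves.SelmerLocalConditionGoodReductionProofs
import Literature.NumberTheory.EllipticCurves.CongruenceVisibilityRefinedCertificate
import HarnessLib

/-!
# Unramified ⟹ Selmer at a NON-SPLIT multiplicative place, and KIND (iv′) of the visibility count
# (cell `b2b-bsdres`, team n1011, row T-NSK = route planner 1's kind (iv′), ROUTE-1 §41.9; seat
# p04 GEN 10; skeleton `cells/n1011/skel/T-NSK.md`; FILE 2 of the row)

HONEST FRAMING (cell `b2b-bsdres`, run/shared/lean/b2b/bsd-rank1-residual/, verbatim in every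
file): the goal of the cell is to DELETE the COMBINATION-SHAPED residual classes of the
Birch–Swinnerton-Dyer formula for ALL analytic-rank `≤ 1` elliptic curves over `ℚ` — "full BSD
formula for every rank `≤ 1` curve in class `C`" assembled STRICTLY from published theorems — so
that the rank-`≤ 1` remainder becomes exactly the CONSTRUCTION-SHAPED classes, which are TYPED
(missing-input `Prop`s), NOT attempted. This is not "finishing BSD". Team n1011 (N10 / N11, the
additive block X4 ∧ `p = 3`): research route on the CONSTRUCTION-SHAPED class X4; no claim beyond
the stated classes; nothing is booked; no mark / label / count is changed by this file. Theorems
only (no definition, no new named fact, no `sorry`); general (any number field, any odd `p`) and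
cell-independent. CONDITIONAL on the registered named fact
`Silverman1994_thmV53_corV54_tateUniformisation` (`hU2`, the cell's A41; and `hU` = A40 for the
packaged count, exactly as the tree's `exists_sha_ne_zero_of_congr_of_places`). The theorems close
NO class by themselves: in the cell they free ONE kind of place in a per-row visibility certificate
whose other inputs (the congruence `θ`, the partner's rank, local torsion counts, the non-square
test for `γ = -c₄/c₆` in `K_v`) are EVIDENCE until kernel-certified.

## What

From FILE 1 (`NonsplitMultiplicativeUnramifiedLocal.lean`: at a place `v` of multiplicative
reduction with `γ(E/K)` a non-square in `K_v`, `p` odd, a crossed homomorphism `Γ_{K_v} → E(K̄_v)`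
with open zero set, vanishing on `I_𝔐`, with `p`-torsion values, is principal):

* `oneCocycleClass_eq_zero_of_nonsplit` — cocycle-class form, allowing the restriction to `I_𝔐`
  to be the coboundary of a `p`-torsion point;
* `unramifiedKer_primeBelow_le_selmerLocalKerOfEmb_of_nonsplit`,
  **`unramifiedKer_le_selmerLocalKer_of_nonsplit`** — `unramifiedKer (E[p]) 𝔓 ≤ 𝓢_v(E)` for every
  prime `𝔓` of `\bar ℤ_K` above a NON-SPLIT multiplicative `v` (any residue characteristic), `p`
  odd: the bad-reduction companion of the tree's `unramifiedKer_le_selmerLocalKer` (good `v ∤ n`,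
  Gross 1991 (7.1) / Milne *ADT* I 3.8), and precisely the hypothesis `hur` of the tree's
  comparison criterion `relIndex_map_selmerLocalKer_eq_one_of_unramifiedKer_le`;
* **`h1Equiv_mem_selmerLocalKer_of_nonsplit_of_hasGoodReductionAt`** /
  `relIndex_map_selmerLocalKer_eq_one_of_nonsplit_of_hasGoodReductionAt` — KIND (iv′): for a
  `Γ_K`-isomorphism `θ : E′[p] ≃ E[p]`, at a place `v ∤ p` where `E` is non-split multiplicative and
  `E′` has GOOD reduction, `θ_* 𝓢_v(E′) ≤ 𝓢_v(E)`, i.e. the comparison index `ι_v(θ)` is `1` — the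
  place is FREE in the visibility count, with NO hypothesis on `E(K_v)[p]`, `E′(K_v)[p]`,
  `ord_v Δ_E` or `c_v(E)` (route planner 1, ROUTE-1 §41.9: "nonsplit-mult / good"; the split
  sub-case never meets a good partner since `E[p]` unramified at `v` forces `p ∣ ord_v Δ_E`);
* `exists_sha_ne_zero_of_congr_of_places₄` — the tree's refined certificate
  `exists_sha_ne_zero_of_congr_of_places` with (iv′) as a FOURTH free kind.

## References

* [MilneADT2006] J. S. Milne, *Arithmetic Duality Theorems*, 2nd ed. (2006), Ch. I Prop. 3.8.
* [GrossLMS1991] B. H. Gross, *Kolyvagin's work on modular elliptic curves*, LMS LNS 153 (1991),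
  §7 (7.1).
* [CremonaMazur2000] J. E. Cremona, B. Mazur, Experiment. Math. 9 (2000), §3 and Table 1.
* [AgasheStein2002] A. Agashe, W. Stein, J. Number Theory 97 (2002), Thm. 3.1, §3.5.
* [SilvermanATAEC1994] J. H. Silverman, *ATAEC*, GTM 151, Ch. V Thm. 3.1, Lemma 5.2, Thm. 5.3,
  Cor. 5.4.
-/

noncomputable section

open scoped Classical Topology Pointwise
open Field NumberField IsDedekindDomain WeierstrassCurve
open Literature.NumberTheory.EllipticCurves Literature.NumberTheory.GaloisRepresentations

namespace Summit.BirchSwinnertonDyer.Rank1Residual.GaloisImage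

namespace NonsplitKummer

/-! ### Global consequences -/

section Global

variable {K : Type} [Field K] [NumberField K] (W : WeierstrassCurve K) [W.IsElliptic]
  (v : HeightOneSpectrum (𝓞 K))

/-- **Cocycle-class form.** At a non-split multiplicative place (`γ(E/K)` a non-square in `K_v`),
`p` odd: a continuous crossed homomorphism `f : Γ_{K_v} → E(K̄_v)` with `p`-torsion values whose
restriction to the inertia group `I_𝔐` is the coboundary of a `p`-torsion point `a` has trivial
class in `H¹(K_v, E)` (`exists_eq_smul_sub_of_nonsplit` applied to `f - ∂a`, whose zero set is
open as it contains `{f = 0} ∩ Stab(a)`). Conditional on `hU2`.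
[cite: MilneADT2006, Ch. I Prop. 3.8] [cite: SilvermanATAEC1994, Ch. V Lemma 5.2 (c), Thm. 5.3, Cor. 5.4] -/
theorem oneCocycleClass_eq_zero_of_nonsplit
    (hU2 : Silverman1994_thmV53_corV54_tateUniformisation.{0})
    (hW : W.HasMultiplicativeReductionAt v)
    (hγ : ¬ IsSquare (algebraMap K (v.adicCompletion K) (-(W.c₄ / W.c₆))))
    {p : ℕ} (hp : Odd p) {𝔐 : Ideal (v.localAbsIntegers)} (h𝔐 : 𝔐 ∈ v.localPrimesAbove)
    (f : contOneCocycles (discreteTopRep (absoluteGaloisGroup (v.adicCompletion K))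
      (localPoints W (v.adicCompletion K))))
    (a : localPoints W (v.adicCompletion K)) (hpa : (p : ℤ) • a = 0)
    (hI : ∀ σ ∈ 𝔐.inertia (absoluteGaloisGroup (v.adicCompletion K)),
      (f.1 σ : localPoints W (v.adicCompletion K)) = σ • a - a)
    (hpf : ∀ σ, (p : ℤ) • (f.1 σ : localPoints W (v.adicCompletion K)) = 0) :
    oneCocycleClass (discreteTopRep (absoluteGaloisGroup (v.adicCompletion K))
      (localPoints W (v.adicCompletion K))) f = 0 := by
  have hf : ∀ σ τ, (f.1 (σ * τ) : localPoints W (v.adicCompletion K)) = f.1 σ + σ • f.1 τ :=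
    fun σ τ ↦ f.2 σ τ
  set g : absoluteGaloisGroup (v.adicCompletion K) → localPoints W (v.adicCompletion K) :=
    fun σ ↦ f.1 σ - (σ • a - a) with hgdef
  have hg : ∀ σ τ, g (σ * τ) = g σ + σ • g τ := crossedHom_sub_coboundary hf a
  have hopen : IsOpen {σ | g σ = 0} := by
    obtain ⟨Z, hZ⟩ := exists_subgroup_coe_eq_zeroSet hg
    rw [← hZ]
    apply Z.isOpen_of_mem_nhds (g := 1)
    have h1 : f.1 ⁻¹' {0} ∈ 𝓝 (1 : absoluteGaloisGroup (v.adicCompletion K)) :=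
      ((isOpen_discrete _).preimage f.1.continuous).mem_nhds (by
        rw [Set.mem_preimage, Set.mem_singleton_iff]; exact crossedHom_one hf)
    have h2 : ((MulAction.stabilizer (absoluteGaloisGroup (v.adicCompletion K)) a : Subgroup _) :
        Set (absoluteGaloisGroup (v.adicCompletion K))) ∈
          𝓝 (1 : absoluteGaloisGroup (v.adicCompletion K)) :=
      (W.isOpen_stabilizer_localPoints (v.adicCompletion K) a).mem_nhds (one_mem _)
    refine Filter.mem_of_superset (Filter.inter_mem h1 h2) fun σ hσ ↦ ?_
    obtain ⟨hσ1, hσ2⟩ := hσ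
    rw [Set.mem_preimage, Set.mem_singleton_iff] at hσ1
    rw [SetLike.mem_coe, MulAction.mem_stabilizer_iff] at hσ2
    rw [hZ, Set.mem_setOf_eq]
    simp only [hgdef, hσ2, sub_self, sub_zero]
    exact hσ1
  have hgI : ∀ σ ∈ 𝔐.inertia (absoluteGaloisGroup (v.adicCompletion K)), g σ = 0 := fun σ hσ ↦ by
    simp only [hgdef, hI σ hσ, sub_self]
  have hpg : ∀ σ, (p : ℤ) • g σ = 0 := fun σ ↦ by
    simp only [hgdef]
    rw [smul_sub, hpf σ, smul_sub, ← W.smul_zsmul_localPoints (p : ℤ) σ a, hpa, smul_zero,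
      sub_self, sub_zero]
  obtain ⟨b, hb⟩ := exists_eq_smul_sub_of_nonsplit W v hU2 hW hγ hp h𝔐 g hg hopen hgI hpg
  rw [oneCocycleClass_eq_zero_iff]
  refine ⟨b + a, fun σ ↦ ?_⟩
  rw [discreteTopRep_ρ_apply]
  change (f.1 σ : localPoints W (v.adicCompletion K)) = σ • (b + a) - (b + a)
  have e1 : (f.1 σ : localPoints W (v.adicCompletion K)) = g σ + (σ • a - a) := by
    simp only [hgdef, sub_add_cancel]
  rw [e1, hb σ, smul_add]
  abel

/-- **Unramified ⟹ local Selmer condition at a NON-SPLIT multiplicative place, along an embedding**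
(the bad-reduction companion of the tree's `unramifiedKer_primeBelow_le_selmerLocalKerOfEmb`,
Gross 1991 (7.1) / Milne *ADT* I Prop. 3.8): `E` multiplicative at `v` with `γ(E/K) = -c₄/c₆` a
non-square in `K_v`, `p` odd (ANY residue characteristic of `v`), `ι : K̄ → K̄_v` a `K`-embedding,
`𝔐` the prime of `\bar 𝓞_v`, `𝔓 = 𝔓_{ι,𝔐}`. A class of `H¹(K, E[p])` unramified at `𝔓` is the
coboundary of some `a ∈ E[p]` on `I_𝔓`; the local inertia group restricts into `I_𝔓`
(`resGalOfEmb_mem_inertia_primeBelow`), so the pulled-back cocycle is `∂(ι_* a)` on `I_𝔐` and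
`oneCocycleClass_eq_zero_of_nonsplit` applies. Conditional on `hU2`.
[cite: MilneADT2006, Ch. I Prop. 3.8] [cite: GrossLMS1991, §7 (7.1)] -/
theorem unramifiedKer_primeBelow_le_selmerLocalKerOfEmb_of_nonsplit
    (hU2 : Silverman1994_thmV53_corV54_tateUniformisation.{0})
    (hW : W.HasMultiplicativeReductionAt v)
    (hγ : ¬ IsSquare (algebraMap K (v.adicCompletion K) (-(W.c₄ / W.c₆))))
    {p : ℕ} (hp : Odd p) (ι : AlgebraicClosure K →ₐ[K] AlgebraicClosure (v.adicCompletion K))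
    {𝔐 : Ideal (v.localAbsIntegers)} (h𝔐 : 𝔐 ∈ v.localPrimesAbove) :
    unramifiedKer (geomTorsion W (p : ℤ)) (v.primeBelow ι 𝔐) ≤
      selmerLocalKerOfEmb W (v.adicCompletion K) ι (p : ℤ) := by
  intro c hc
  obtain ⟨φ, rfl⟩ :=
    oneCocycleClass_surjective (discreteTopRep (absoluteGaloisGroup K) (geomTorsion W (p : ℤ))) c
  obtain ⟨a, ha⟩ := (oneCocycleClass_mem_subgroupResKer_iff _ φ).mp hc
  unfold selmerLocalKerOfEmb
  rw [mem_resKer_iff, map_oneCocycleClass]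
  refine oneCocycleClass_eq_zero_of_nonsplit W v hU2 hW hγ hp h𝔐 _
    (pointsMapOfEmb W ι (a : geomPoints W)) ?_ (fun σ hσ ↦ ?_) (fun σ ↦ ?_)
  · rw [← map_zsmul, (Submodule.mem_torsionBy_iff (p : ℤ) _).mp a.2, map_zero]
  · rw [contOneCocycles.pullback_apply]
    have h0 := ha ⟨resGalOfEmb ι σ, v.resGalOfEmb_mem_inertia_primeBelow ι 𝔐 hσ⟩
    change pointsMapOfEmb W ι ((φ.1 (resGalOfEmb ι σ) : geomTorsion W (p : ℤ)) : geomPoints W) = _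
    rw [h0, AddSubgroupClass.coe_sub, map_sub,
      Literature.NumberTheory.EllipticCurves.AddSubgroup.torsionBy.coe_smul, pointsMapOfEmb_smul]
  · rw [contOneCocycles.pullback_apply]
    change (p : ℤ) • pointsMapOfEmb W ι ((φ.1 (resGalOfEmb ι σ) : geomTorsion W (p : ℤ)) :
      geomPoints W) = 0
    rw [← map_zsmul, (Submodule.mem_torsionBy_iff (p : ℤ) _).mp (φ.1 (resGalOfEmb ι σ)).2, map_zero]

/-- **Unramified ⟹ local Selmer condition at a NON-SPLIT multiplicative place** — for an elliptic
curve `E/K` over a number field, a finite place `v` (any residue characteristic) of multiplicative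
reduction with `γ(E/K) = -c₄/c₆` a non-square in `K_v`, an odd `p`, and ANY prime `𝔓` of `\bar ℤ_K`
above `v`: `unramifiedKer (geomTorsion W p) 𝔓 ≤ selmerLocalKer W (v.adicCompletion K) p`. This is
the hypothesis `hur` of the tree's comparison criterion
`relIndex_map_selmerLocalKer_eq_one_of_unramifiedKer_le` ("`H¹(K_v^nr/K_v, E(K_v^nr))[p] = 0`",
Milne I 3.8: that group is `H¹(k_v, Φ_v)`, of order the Tamagawa number — `1` or `2` at a
non-split place). Reduction to the embedding form exactly as in the good-reduction theorem
`unramifiedKer_le_selmerLocalKer` (`Γ_K` is transitive on the primes above `v`,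
`exists_smul_eq_of_mem_primesAbove_holds`; `primeBelow_comp`; `selmerLocalKer_eq_of_algHom_holds`).
Conditional on `hU2`. [cite: MilneADT2006, Ch. I Prop. 3.8] [cite: GrossLMS1991, §7 (7.1)] -/
theorem unramifiedKer_le_selmerLocalKer_of_nonsplit
    (hU2 : Silverman1994_thmV53_corV54_tateUniformisation.{0})
    (hW : W.HasMultiplicativeReductionAt v)
    (hγ : ¬ IsSquare (algebraMap K (v.adicCompletion K) (-(W.c₄ / W.c₆))))
    {p : ℕ} (hp : Odd p) {𝔓 : Ideal (absIntegers (𝓞 K) K)} (h𝔓 : 𝔓 ∈ v.primesAbove) :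
    unramifiedKer (geomTorsion W (p : ℤ)) 𝔓 ≤ selmerLocalKer W (v.adicCompletion K) (p : ℤ) := by
  obtain ⟨𝔐, h𝔐⟩ := v.localPrimesAbove_nonempty
  obtain ⟨g, hg⟩ := HeightOneSpectrum.exists_smul_eq_of_mem_primesAbove_holds
    (HeightOneSpectrum.primeBelow_mem_primesAbove
      (ι := closureEmb (K := K) (v.adicCompletion K)) h𝔐) h𝔓
  have h1 : 𝔓 = v.primeBelow ((closureEmb (K := K) (v.adicCompletion K)).comp
      ((show AlgebraicClosure K ≃ₐ[K] AlgebraicClosure K from g⁻¹) :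
        AlgebraicClosure K →ₐ[K] AlgebraicClosure K)) 𝔐 := by
    rw [HeightOneSpectrum.primeBelow_comp, ← hg]
    exact congrArg (· • _) (inv_inv g).symm
  rw [h1, ← selmerLocalKer_eq_of_algHom_holds W (v.adicCompletion K) _ (p : ℤ)]
  exact unramifiedKer_primeBelow_le_selmerLocalKerOfEmb_of_nonsplit W v hU2 hW hγ hp _ h𝔐

/-- **KIND (iv′): the local Kummer conditions of two `p`-congruent curves agree at a place where
`E` is NON-SPLIT multiplicative and `E′` has GOOD reduction, `v ∤ p`, `p` odd** (route planner 1,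
ROUTE-1 §41.9: the place is FREE in the visibility count; level-raising shape — `E[p] ≅ E′[p]` is
unramified at `v` although `E` is bad there). `θ_* 𝓢_v(E′) ≤ 𝓢_v(E)`: the local condition of `E′`
at `v` is "unramified" (`selmerLocalKer_eq_unramifiedKer`, good `v ∤ p`), unramifiedness passes
through `θ` (`mem_unramifiedKer_iff_h1Equiv_mem`), and unramified classes of `E[p]` are Selmer for
`E` at `v` (`unramifiedKer_le_selmerLocalKer_of_nonsplit`). No hypothesis on `E(K_v)[p]`,
`E′(K_v)[p]`, `ord_v Δ_E` or `c_v(E)`. Conditional on `hU2`.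
[cite: MilneADT2006, Ch. I Prop. 3.8] [cite: GrossLMS1991, §7 (7.1)]
[cite: CremonaMazur2000, §3] -/
theorem h1Equiv_mem_selmerLocalKer_of_nonsplit_of_hasGoodReductionAt
    (hU2 : Silverman1994_thmV53_corV54_tateUniformisation.{0}) {p : ℕ} [hpr : Fact p.Prime]
    (hp2 : p ≠ 2) (W' : WeierstrassCurve K) [W'.IsElliptic]
    (θ : geomTorsion W' (p : ℤ) ≃+ geomTorsion W (p : ℤ))
    (hθ : ∀ (σ : absoluteGaloisGroup K) (P : geomTorsion W' (p : ℤ)), θ (σ • P) = σ • θ P)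
    (hW : W.HasMultiplicativeReductionAt v)
    (hγ : ¬ IsSquare (algebraMap K (v.adicCompletion K) (-(W.c₄ / W.c₆))))
    (hW' : W'.HasGoodReductionAt v) (hv : (p : 𝓞 K) ∉ v.asIdeal)
    {c : galH1Torsion W' (p : ℤ)} (hc : c ∈ selmerLocalKer W' (v.adicCompletion K) (p : ℤ)) :
    h1Equiv θ hθ c ∈ selmerLocalKer W (v.adicCompletion K) (p : ℤ) := by
  obtain ⟨𝔓, h𝔓⟩ := v.primesAbove_nonempty
  have hn : ((p : ℤ) : 𝓞 K) ∉ v.asIdeal := by rwa [Int.cast_natCast]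
  refine unramifiedKer_le_selmerLocalKer_of_nonsplit W v hU2 hW hγ (hpr.out.odd_of_ne_two hp2) h𝔓 ?_
  rw [← mem_unramifiedKer_iff_h1Equiv_mem, ← W'.selmerLocalKer_eq_unramifiedKer hW' hn h𝔓]
  exact hc

/-- **`ι_v(θ) = 1` at a kind-(iv′) place** (`E` non-split multiplicative, `E′` good, `v ∤ p`, `p`
odd): the comparison index of `CongruenceVisibilityComparison.lean` is `1`. Conditional on `hU2`.
[cite: MilneADT2006, Ch. I Prop. 3.8] [cite: CremonaMazur2000, §3] -/
theorem relIndex_map_selmerLocalKer_eq_one_of_nonsplit_of_hasGoodReductionAt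
    (hU2 : Silverman1994_thmV53_corV54_tateUniformisation.{0}) {p : ℕ} [Fact p.Prime]
    (hp2 : p ≠ 2) (W' : WeierstrassCurve K) [W'.IsElliptic]
    (θ : geomTorsion W' (p : ℤ) ≃+ geomTorsion W (p : ℤ))
    (hθ : ∀ (σ : absoluteGaloisGroup K) (P : geomTorsion W' (p : ℤ)), θ (σ • P) = σ • θ P)
    (hW : W.HasMultiplicativeReductionAt v)
    (hγ : ¬ IsSquare (algebraMap K (v.adicCompletion K) (-(W.c₄ / W.c₆))))
    (hW' : W'.HasGoodReductionAt v) (hv : (p : 𝓞 K) ∉ v.asIdeal) :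
    (selmerLocalKer W (v.adicCompletion K) (p : ℤ)).relIndex
        ((selmerLocalKer W' (v.adicCompletion K) (p : ℤ)).map (h1Equiv θ hθ).toAddMonoidHom) = 1 :=
  (relIndex_map_selmerLocalKer_eq_one_iff W W' θ hθ).mpr fun _ hc ↦
    h1Equiv_mem_selmerLocalKer_of_nonsplit_of_hasGoodReductionAt W v hU2 hp2 W' θ hθ hW hγ hW' hv hc

/-- **The refined visibility certificate with FOUR free kinds** (sequel of the tree's
`exists_sha_ne_zero_of_congr_of_places`): `p` an odd prime, `θ : E′[p] ⥲ E[p]` a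
`Γ_K`-isomorphism, `S ⊇ T` finite sets of finite places with both curves good and `v ∤ p` outside
`S`, `E(K)` finite of order prime to `p`, (a) `∏_{v ∈ T} #E′(K_v)[p] · #(𝓞_v/p) < p^{rank E′(K)}`,
and (b) every `v ∈ S \ T` of one of the free kinds (i) `v ∤ p`, `E′(K_v)[p] = 0`; (ii) both split
multiplicative, `#E(K_v)[p] ≤ p`; (iii) both multiplicative, `γ(E) = r² γ(E′)` in `K_v`,
`μ_p(K_v) = 1`; **(iv′) `E` multiplicative with `γ(E)` a non-square in `K_v` (non-split), `E′`
good at `v`, `v ∤ p`**. Then `Ш(E/K)` has a non-zero element killed by `p`. Conditional on the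
Tate uniformisation facts `hU`, `hU2`. [cite: CremonaMazur2000, §3 and Table 1]
[cite: AgasheStein2002, Thm. 3.1 and §3.5]
[cite: SilvermanATAEC1994, Ch. V Thm. 3.1, Lemma 5.2, Thm. 5.3, Cor. 5.4]
[cite: MilneADT2006, Ch. I Prop. 3.8] -/
theorem exists_sha_ne_zero_of_congr_of_places₄
    (hU : Silverman1994_thmV53_tateUniformisation.{0})
    (hU2 : Silverman1994_thmV53_corV54_tateUniformisation.{0}) {p : ℕ} [hpr : Fact p.Prime]
    (hp2 : p ≠ 2) (W' : WeierstrassCurve K) [W'.IsElliptic]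
    (θ : geomTorsion W' (p : ℤ) ≃+ geomTorsion W (p : ℤ))
    (hθ : ∀ (σ : absoluteGaloisGroup K) (P : geomTorsion W' (p : ℤ)), θ (σ • P) = σ • θ P)
    (S T : Finset (HeightOneSpectrum (𝓞 K))) (hTS : T ⊆ S)
    (hS : ∀ w : HeightOneSpectrum (𝓞 K), w ∉ S →
      W.HasGoodReductionAt w ∧ W'.HasGoodReductionAt w ∧ (p : 𝓞 K) ∉ w.asIdeal)
    (hfin : Finite W.toAffine.Point) (hcop : (Nat.card W.toAffine.Point).Coprime p)
    (hT : (∏ w ∈ T, Nat.card (nsmulAddMonoidHom p :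
        (W'.baseChange (w.adicCompletion K)).toAffine.Point →+ _).ker *
        Nat.card (w.adicCompletionIntegers K ⧸
          Ideal.span {(p : w.adicCompletionIntegers K)})) < p ^ W'.mordellWeilRank)
    (hplaces : ∀ w ∈ S, w ∉ T →
      ((p : 𝓞 K) ∉ w.asIdeal ∧ Nat.card (nsmulAddMonoidHom p :
          (W'.baseChange (w.adicCompletion K)).toAffine.Point →+ _).ker = 1) ∨
      (W.HasSplitMultiplicativeReductionAt w ∧ W'.HasSplitMultiplicativeReductionAt w ∧
        Nat.card (nsmulAddMonoidHom p :
          (W.baseChange (w.adicCompletion K)).toAffine.Point →+ _).ker ≤ p) ∨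
      (W.HasMultiplicativeReductionAt w ∧ W'.HasMultiplicativeReductionAt w ∧
        (∃ r : w.adicCompletion K, algebraMap K (w.adicCompletion K) (-(W.c₄ / W.c₆)) =
          r ^ 2 * algebraMap K (w.adicCompletion K) (-(W'.c₄ / W'.c₆))) ∧
        (∀ ζ : w.adicCompletion K, ζ ^ p = 1 → ζ = 1)) ∨
      (W.HasMultiplicativeReductionAt w ∧
        ¬ IsSquare (algebraMap K (w.adicCompletion K) (-(W.c₄ / W.c₆))) ∧
        W'.HasGoodReductionAt w ∧ (p : 𝓞 K) ∉ w.asIdeal)) :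
    ∃ c : W.sha, c ≠ 0 ∧ p • c = 0 := by
  have hpp : p.Prime := hpr.out
  haveI := hfin
  refine exists_sha_ne_zero_of_congr_of_le_off W W' hp2 θ hθ S T hTS hS (fun w hw hwT c hc ↦ ?_) ?_
  · rcases hplaces w hw hwT with ⟨hwp, hloc⟩ | ⟨hWw, hW'w, hcardw⟩ | ⟨hWw, hW'w, hγw, hμw⟩ |
        ⟨hWw, hγw, hW'w, hwp⟩
    · exact (relIndex_map_selmerLocalKer_eq_one_iff W W' θ hθ).mp
        (relIndex_map_selmerLocalKer_eq_one_of_card_torsion_eq_one W W' θ hθ hwp hloc) c hc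
    · exact W.h1Equiv_mem_selmerLocalKer_of_hasSplitMultiplicativeReductionAt w hU W' θ hθ hWw
        hW'w hcardw hc
    · exact W.h1Equiv_mem_selmerLocalKer_of_hasMultiplicativeReductionAt w hU2 hp2 W' θ hθ hWw
        hW'w hγw hμw hc
    · exact h1Equiv_mem_selmerLocalKer_of_nonsplit_of_hasGoodReductionAt W w hU2 hp2 W' θ hθ hWw
        hγw hW'w hwp hc
  · rw [index_range_zsmul_eq_one_of_coprime hcop, one_mul,
      Finset.prod_congr rfl fun w _ ↦
        (W'.natCard_kummerLocalConditionAt_adicCompletion w hpp.ne_zero)]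
    exact lt_of_lt_of_le hT (pow_mordellWeilRank_le_index_range_zsmul W' hpp.ne_zero)

end Global

end NonsplitKummer

end Summit.BirchSwinnertonDyer.Rank1Residual.GaloisImage

end
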